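import Literature.MathematicalPhysics.QuantumFieldTheory.Balaban1983to89.PolyakovDiagonalBound
import Literature.MathematicalPhysics.QuantumFieldTheory.Balaban1983to89.T3TailTransfer
import Literature.MathematicalPhysics.QuantumFieldTheory.Balaban1983to89.T3CentreSymmetry
import HarnessLib

/-!
# `Balaban1983to89.T3PolyakovVariance` — rung R3, the NON-TRIVIALITY binder (NT3) of the continuum `SU(2)` YM₃ loop law:
# its one-cutoff margin is a THEOREM (`⟨W̄_P²⟩₀ ≥ 1/4` by reflection positivity), so NT3 follows from K1 ∧ K2 with a small tail

CITATION HEADER (lean-in-tree rule).  Cell `ym3-torus` (HUMAN RULING D-0037, YM ladder rung R3), seat `ym3-torus-p2` gen 6 («non-Gaussianity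
witness» of the seat's purpose; HOME/IR-NODE.md §3, §10.6, §12).  Sources: C. Borgs, E. Seiler, Commun. Math. Phys. **91** (1983) 329
[BorgsSeiler1983] §III.1 (III.23) p. 347 (`⟨|Tr u|²⟩ ≥ 1` for the Polyakov loop by reflection positivity; tree `PolyakovDiagonalBound`);
C. King, Commun. Math. Phys. **102** (1986) 649 [King1986] Thm 3.4 (3.13) p. 657 (the Cauchy/transfer device; tree `T3TailTransfer`);
S. Chatterjee in Friz et al. (eds.) 2019 [Chatterjee2019YMProbabilists] §6 p. 19 (non-trivial behaviour of Wilson loop variables in a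
continuum limit of a lattice gauge theory in `d ≥ 3` is open); L. McLerran, B. Svetitsky, Phys. Lett. B **98** (1981) 195
[McLerranSvetitsky1981] (the Polyakov line is odd under the centre, `⟨W̄_P⟩ = 0`; tree `T3CentreSymmetry`).

THE POINT.  The cell's IR node (HOME/IR-NODE.md §3) located the honest content of «the continuum loop law is non-Gaussian» for bounded loop
variables as NON-DEGENERACY, typed as the schema `T3LoopLawNondegenerate.UniformVariance S C c` (a `K`-uniform variance lower bound for one
label), and `T3TailTransfer` (gen 3) reduced it to K1 ∧ K2 plus «a margin at ONE cutoff `K₀`», then expected to need a finite-lattice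
computation.  THIS FILE SUPPLIES THE MARGIN AS A THEOREM AT `K₀ = 0`, for every coupling, every block size and every volume: at `K = 0` the
scheme's averaged field IS the bare field (`Averaging.iter _ 0 = id`), the Polyakov label's representative is the straight temporal line once
around the unit torus, and Borgs–Seiler's reflection-positivity bound gives `⟨W̄_P · W̄_P⟩₀ ≥ 1/4` (`expectAt_zero_polyakov_pair_ge`), i.e.
`⟨W̄_{P·P}⟩₀ ≥ −1/2` (`expectAt_zero_polyakov_double_ge`).  Consequently (`SU(2)`, every measurable small-loop average `ℰ`, `γ ≥ 0`):

* `le_expectAt_polyakov_pair` — under `UnitTiltTail F ℰ γ r w w'` (K1 ∧ K2 for the family, summable non-negative `r, w, w'`) every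
  `a` with `a + Σ_i (8rᵢ + 4wᵢ + 2w'ᵢ) ≤ 1/4` bounds `⟨W̄_P W̄_P⟩_K` from below at EVERY `K`;
* **`uniformVariance_polyakov_of_unitTiltTail`** — hence `UniformVariance (F.scheme ℰ γ) (polyakov 0 x) c` for every `0 < c` with
  `c + Σ(8r + 4w + 2w') ≤ 1/4` (centre symmetry kills the mean at every `K`): **NT3 ⇐ K1 ∧ K2 WITH A SMALL TOTAL TAIL, and nothing else**;
* `continuumYM3Torus_nontrivial_of_unitTiltTail` — `ContinuumYM3Torus F ℰ γ ∧ LimitPointsNontrivial (F.scheme ℰ γ)` (the rung's four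
  conjuncts AND the non-triviality conjunct of `ContinuumYM3TorusNG`) from the same hypothesis; `limitLoopLaw_polyakov_nondegenerate` — the
  limit loop law exists, carries every limit point, has `Var(x_P) ≥ c` and its Polyakov marginal is NOT Gaussian.
* `quarter_le_bare_polyakov_sq` — hypothesis-free, at EVERY `K`: the BARE (un-averaged) Polyakov loop of the `K`-th lattice keeps second
  moment `≥ 1/4` (thin loops never concentrate; for the scheme's AVERAGED observables at `K ≥ 1` reflection positivity does not split the
  loop, whence the transfer from `K₀ = 0`).

WHAT THIS IS NOT.  Not a proof of NT3 or of K1/K2: the smallness `Σ(8r + 4w + 2w') < 1/4` of the K1 ∧ K2 tail is an INPUT (the route's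
`UnitTiltAt`/`HistoryTailAt` give summability only; the radii `r_K = sup|h_K|` are extensive, so the expected size is `Σ r ≲ C(L, m)·γ`,
small for `γ ≤ γ₂(F)` — a per-torus threshold); not a statement about the `n`-fold averaged Polyakov loop at a refined family's threshold
index; not deconfinement physics.
-/

noncomputable section

open MeasureTheory Filter Topology ProbabilityTheory
open Literature.MathematicalPhysics.QuantumFieldTheory.Balaban1983to89.T4Continuum
open Literature.MathematicalPhysics.QuantumFieldTheory.Balaban1983to89.T3ContinuumYM3Torus
open Literature.MathematicalPhysics.QuantumFieldTheory.Balaban1983to89.T3ThresholdRemoval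
open Literature.MathematicalPhysics.QuantumFieldTheory.Balaban1983to89.T3UnitScaleTilt
open Literature.MathematicalPhysics.QuantumFieldTheory.Balaban1983to89.T3TailTransfer
open Literature.MathematicalPhysics.QuantumFieldTheory.Balaban1983to89.PolyakovDiagonalBound

namespace Literature.MathematicalPhysics.QuantumFieldTheory.Balaban1983to89.T3PolyakovVariance

variable {F : T3Family}

/-! ## 1. The Polyakov label at `K = 0` is the straight temporal line once around the unit torus -/

/-- The unit torus of the `K`-th approximation has `2L^{m+K}` sites per direction at its finest level (private twin of the node's lemma;
gate dedup). [cite: Balaban1985UV3, (1)-(3) p.256] -/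
private theorem sitesPerDir_zero' (F : T3Family) (K : ℕ) : (F.P K).sitesPerDir 0 = 2 * F.L ^ (F.m + K) := by
  simp [Params.sitesPerDir]

/-- At `K = 0` the Polyakov label's lattice representative is the straight temporal walk of `sitesPerDir 0 = 2L^m` forward steps from
its base point. [cite: McLerranSvetitsky1981] -/
theorem atLevel_zero_polyakov (x : F.USite) :
    (ULoop3.polyakov 0 x).1.atLevel 0 = walk x (List.replicate ((F.P 0).sitesPerDir 0) ((0 : Fin 3), true)) := by
  show walk (F.toLevel 0 x) (List.replicate (2 * F.L ^ F.m) ((0 : Fin 3), true)) = _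
  rw [toLevel_zero, sitesPerDir_zero', add_zero]

section SU2

variable (F) (ℰ : LoopAverage (Matrix.specialUnitaryGroup (Fin 2) ℂ)) {γ : ℝ}

/-- **THE MARGIN AT `K₀ = 0`**: `1/4 ≤ ⟨W̄_P · W̄_P⟩₀` for the Polyakov label through any base point in the hyperplane `t = 0`, every
small-loop average `ℰ` (none is applied at `K = 0`), every `γ ≥ 0`, every torus family — Borgs–Seiler's reflection-positivity bound
`PolyakovDiagonalBound.quarter_le_expect_loopAt_sq_polyakov` read on the scheme. [cite: BorgsSeiler1983, §III.1 (III.23) p.347] -/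
theorem expectAt_zero_polyakov_pair_ge (hγ : 0 ≤ γ) {x : F.USite} (hx : x 0 = 0) :
    (1 : ℝ) / 4 ≤ (F.scheme ℰ γ).expectAt 0 [ULoop3.polyakov 0 x, ULoop3.polyakov 0 x] := by
  have h := quarter_le_expect_loopAt_sq_polyakov (F.P 0) (F.scheme_β_nonneg ℰ hγ 0) hx
  have heq : (F.scheme ℰ γ).expectAt 0 [ULoop3.polyakov 0 x, ULoop3.polyakov 0 x] =
      Missing.expect (F.P 0) ((F.scheme ℰ γ).β 0) fun U : GaugeField (F.P 0) 0 (Matrix.specialUnitaryGroup (Fin 2) ℂ) =>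
        loopAt U (walk x (List.replicate ((F.P 0).sitesPerDir 0) ((0 : Fin 3), true))) ^ 2 := by
    show Missing.expect (F.P 0) ((F.scheme ℰ γ).β 0) (fun U => ([ULoop3.polyakov 0 x, ULoop3.polyakov 0 x].map
      fun C => F.avgObs ℰ 0 C U).prod) = _
    congr 1
    funext U
    simp only [List.map_cons, List.map_nil, List.prod_cons, List.prod_nil, mul_one]
    show loopAt U ((ULoop3.polyakov 0 x).1.atLevel 0) * loopAt U ((ULoop3.polyakov 0 x).1.atLevel 0) = _
    rw [atLevel_zero_polyakov, sq]
  rw [heq]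
  exact h

/-- Equivalently **`−1/2 ≤ ⟨W̄_{P·P}⟩₀`**: at the unit cutoff the doubly-wound Polyakov loop stays `1/2` above `−1` (IR-NODE §10.6's
one-cutoff margin, now a theorem; measurable `ℰ` for the tree's `expectAt_pair_eq`). [cite: BorgsSeiler1983, §III.1 (III.23) p.347] -/
theorem expectAt_zero_polyakov_double_ge (hE : ℰ.MeasurableE) (hγ : 0 ≤ γ) {x : F.USite} (hx : x 0 = 0) :
    -(1 : ℝ) / 2 ≤ (F.scheme ℰ γ).expectAt 0 [(ULoop3.polyakov 0 x).double] := by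
  have h1 := expectAt_zero_polyakov_pair_ge F ℰ hγ hx
  rw [expectAt_pair_eq F hE hγ 0] at h1
  linarith

/-- **HYPOTHESIS-FREE, AT EVERY CUTOFF: THE BARE POLYAKOV LOOP NEVER CONCENTRATES** — for every `K`, the un-averaged Polyakov loop
variable of the `K`-th lattice (`2L^{m+K}` temporal links at the finest level, coupling `β_K = (γε_K)⁻¹`) has `⟨W²⟩ ≥ 1/4`.  (Not a
scheme observable for `K ≥ 1`; recorded to mark what reflection positivity gives uniformly in the cutoff.) [cite: BorgsSeiler1983, §III.1 (III.23) p.347] -/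
theorem quarter_le_bare_polyakov_sq (hγ : 0 ≤ γ) (K : ℕ) {y : Site (F.P K) 0} (hy : y 0 = 0) :
    (1 : ℝ) / 4 ≤ Missing.expect (F.P K) ((F.scheme ℰ γ).β K)
      fun U : GaugeField (F.P K) 0 (Matrix.specialUnitaryGroup (Fin 2) ℂ) =>
        loopAt U (walk y (List.replicate ((F.P K).sitesPerDir 0) (0, true))) ^ 2 :=
  quarter_le_expect_loopAt_sq_polyakov (F.P K) (F.scheme_β_nonneg ℰ hγ K) hy

/-! ## 2. Transfer: under K1 ∧ K2 with a small total tail the margin survives at every cutoff -/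

variable {F ℰ} {r w w' : ℕ → ℝ}

/-- The unit-field observable `W̄_P · W̄_P` of the Polyakov label: measurable and bounded by `1`. [cite: Balaban1987RG1, (0.2)/(0.4) p.252] -/
private theorem measurable_pairObs (x : F.USite) :
    Measurable (fun u : GaugeField (F.P 0) 0 (Matrix.specialUnitaryGroup (Fin 2) ℂ) =>
        ([ULoop3.polyakov 0 x, ULoop3.polyakov 0 x].map fun C => loopAt u (C.1.atLevel 0)).prod) ∧
      ∀ u : GaugeField (F.P 0) 0 (Matrix.specialUnitaryGroup (Fin 2) ℂ),
        |([ULoop3.polyakov 0 x, ULoop3.polyakov 0 x].map fun C => loopAt u (C.1.atLevel 0)).prod| ≤ 1 := by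
  simp only [List.map_cons, List.map_nil, List.prod_cons, List.prod_nil, mul_one]
  refine ⟨(measurable_loopAt _).mul (measurable_loopAt _), fun u => ?_⟩
  rw [abs_mul]
  have h1 := abs_loopAt_le_one u ((ULoop3.polyakov (F := F) 0 x).1.atLevel 0)
  nlinarith [abs_nonneg (loopAt u ((ULoop3.polyakov (F := F) 0 x).1.atLevel 0))]

/-- **THE MARGIN SURVIVES AT EVERY CUTOFF**: under `UnitTiltTail F ℰ γ r w w'` (K1 ∧ K2 for the family: consecutive unit laws are tilts of
radius `r_K` off events of mass `≤ w_K, w'_K`, all summable and non-negative), every `a` with `a + Σ_i (8rᵢ + 4wᵢ + 2w'ᵢ) ≤ 1/4` satisfies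
`a ≤ ⟨W̄_P · W̄_P⟩_K` for ALL `K` — King's four-measure telescoping (`T3TailTransfer.le_integral_unitLaw_of_le_at`) started at `K₀ = 0`,
where the margin is the theorem `expectAt_zero_polyakov_pair_ge`. [cite: King1986, Thm 3.4 (3.13) p.657] -/
theorem le_expectAt_polyakov_pair (hE : ℰ.MeasurableE) (hγ : 0 ≤ γ) (h : UnitTiltTail F ℰ γ r w w') (hr : Summable r)
    (hw : Summable w) (hw' : Summable w') (hr0 : ∀ K, 0 ≤ r K) (hw0 : ∀ K, 0 ≤ w K) (hw0' : ∀ K, 0 ≤ w' K) {x : F.USite}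
    (hx : x 0 = 0) {a : ℝ} (ha : a + ∑' i, (8 * r i + 4 * w i + 2 * w' i) ≤ 1 / 4) :
    ∀ K, a ≤ (F.scheme ℰ γ).expectAt K [ULoop3.polyakov 0 x, ULoop3.polyakov 0 x] := by
  obtain ⟨hWm, hW1⟩ := measurable_pairObs (F := F) x
  have h0 := expectAt_zero_polyakov_pair_ge F ℰ hγ hx
  rw [expectAt_eq_integral_unitLaw hE hγ 0] at h0
  have ha' : a + ∑' i, (8 * r (0 + i) + 4 * w (0 + i) + 2 * w' (0 + i)) ≤
      ∫ u, ([ULoop3.polyakov 0 x, ULoop3.polyakov 0 x].map fun C => loopAt u (C.1.atLevel 0)).prod ∂F.unitLaw ℰ hE γ 0 := by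
    simp only [zero_add]
    exact ha.trans h0
  intro K
  rw [expectAt_eq_integral_unitLaw hE hγ K]
  exact le_integral_unitLaw_of_le_at hE hγ h hr hw hw' hr0 hw0 hw0' hWm hW1 ha' K (Nat.zero_le K)

/-! ## 3. NT3 from K1 ∧ K2 with a small tail; the continuum Polyakov-loop law is non-degenerate and non-Gaussian -/

/-- **NT3 ⇐ K1 ∧ K2 WITH A SMALL TOTAL TAIL.**  For `SU(2)`, measurable `ℰ`, `γ ≥ 0`: if `UnitTiltTail F ℰ γ r w w'` holds with summable
non-negative rates and `c + Σ(8r + 4w + 2w') ≤ 1/4`, `0 < c`, then the Polyakov label through any base point in the hyperplane `t = 0`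
has `K`-UNIFORM VARIANCE `≥ c`: `UniformVariance (F.scheme ℰ γ) (polyakov 0 x) c` (the mean vanishes at every `K` by centre symmetry,
`T3CentreSymmetry.expectAt_eq_zero_of_odd_SU2`).  The located open content of the NG conjunct (IR-NODE §3: «OPEN, not in print») is
thereby REDUCED to a quantitative form of the route's own cruxes K1 ∧ K2 — no separate estimate, no lattice computation. [cite: Chatterjee2019YMProbabilists, §6 p.19] -/
theorem uniformVariance_polyakov_of_unitTiltTail (hE : ℰ.MeasurableE) (hγ : 0 ≤ γ) (h : UnitTiltTail F ℰ γ r w w')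
    (hr : Summable r) (hw : Summable w) (hw' : Summable w') (hr0 : ∀ K, 0 ≤ r K) (hw0 : ∀ K, 0 ≤ w K) (hw0' : ∀ K, 0 ≤ w' K)
    {x : F.USite} (hx : x 0 = 0) {c : ℝ} (hc : 0 < c) (hsmall : c + ∑' i, (8 * r i + 4 * w i + 2 * w' i) ≤ 1 / 4) :
    UniformVariance (F.scheme ℰ γ) (ULoop3.polyakov 0 x) c := by
  refine ⟨hc, Eventually.of_forall fun K => ?_⟩
  rw [expectAt_eq_zero_of_odd_SU2 F ℰ γ K (μ := 0) (Cs := [ULoop3.polyakov 0 x])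
    (by rw [List.map_singleton, List.sum_singleton, ULoop3.wind_polyakov]; exact odd_one)]
  simpa using le_expectAt_polyakov_pair hE hγ h hr hw hw' hr0 hw0 hw0' hx hsmall K

/-- Hence **every continuum-limit point is NON-TRIVIAL** (the conjunct `LimitPointsNontrivial` of `ContinuumYM3TorusNG`) under K1 ∧ K2 with
a small tail. [cite: JaffeWittenClay2006, §4 p.6] -/
theorem limitPointsNontrivial_of_unitTiltTail (hE : ℰ.MeasurableE) (hγ : 0 ≤ γ) (h : UnitTiltTail F ℰ γ r w w')
    (hr : Summable r) (hw : Summable w) (hw' : Summable w') (hr0 : ∀ K, 0 ≤ r K) (hw0 : ∀ K, 0 ≤ w K) (hw0' : ∀ K, 0 ≤ w' K)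
    (hsmall : ∑' i, (8 * r i + 4 * w i + 2 * w' i) < 1 / 4) : LimitPointsNontrivial (F.scheme ℰ γ) := by
  have hx : (0 : F.USite) 0 = 0 := rfl
  exact limitPointsNontrivial_of_uniformVariance
    (uniformVariance_polyakov_of_unitTiltTail hE hγ h hr hw hw' hr0 hw0 hw0' hx
      (c := (1 / 4 - ∑' i, (8 * r i + 4 * w i + 2 * w' i)) / 2) (by linarith) (by linarith))

/-- **THE RUNG'S TARGET PLUS NON-TRIVIALITY FROM K1 ∧ K2 WITH A SMALL TAIL**: `ContinuumYM3Torus F ℰ γ` (existence of the full-sequence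
limit of all joint expectations, uniqueness of the limit points, reflection positivity, torus covariance — tree
`continuumYM3Torus_of_unitTiltTail`) AND `LimitPointsNontrivial (F.scheme ℰ γ)`, for `SU(2)`, measurable `ℰ`, `γ ≥ 0`. [cite: JaffeWittenClay2006, §6.5 p.11] -/
theorem continuumYM3Torus_nontrivial_of_unitTiltTail (hE : ℰ.MeasurableE) (hγ : 0 ≤ γ) (h : UnitTiltTail F ℰ γ r w w')
    (hr : Summable r) (hw : Summable w) (hw' : Summable w') (hr0 : ∀ K, 0 ≤ r K) (hw0 : ∀ K, 0 ≤ w K) (hw0' : ∀ K, 0 ≤ w' K)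
    (hsmall : ∑' i, (8 * r i + 4 * w i + 2 * w' i) < 1 / 4) :
    ContinuumYM3Torus F ℰ γ ∧ LimitPointsNontrivial (F.scheme ℰ γ) :=
  ⟨continuumYM3Torus_of_unitTiltTail F ℰ hE hγ hr hw hw' h,
    limitPointsNontrivial_of_unitTiltTail hE hγ h hr hw hw' hr0 hw0 hw0' hsmall⟩

/-- **THE CONTINUUM POLYAKOV-LOOP LAW IS NON-DEGENERATE AND NON-GAUSSIAN** under K1 ∧ K2 with a small tail: the loop laws converge weakly
to a probability law `ν` on the cube `[-1,1]^{ULoop3 F}` carrying every limit of the joint expectations, with `Var_ν(x_P) ≥ c` and the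
`P`-marginal of `ν` different from every Gaussian (tree `limitLoopLaw_nondegenerate`). [cite: Chatterjee2019YMProbabilists, §6 p.19] -/
theorem limitLoopLaw_polyakov_nondegenerate (hE : ℰ.MeasurableE) (hγ : 0 ≤ γ) (h : UnitTiltTail F ℰ γ r w w')
    (hr : Summable r) (hw : Summable w) (hw' : Summable w') (hr0 : ∀ K, 0 ≤ r K) (hw0 : ∀ K, 0 ≤ w K) (hw0' : ∀ K, 0 ≤ w' K)
    {x : F.USite} (hx : x 0 = 0) {c : ℝ} (hc : 0 < c) (hsmall : c + ∑' i, (8 * r i + 4 * w i + 2 * w' i) ≤ 1 / 4) :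
    ∃ ν : ProbabilityMeasure (T4LimitLaw.Cube (ULoop3 F)),
      Tendsto (loopLaw F (F.avgMeasurable_of_measurableE ℰ hE) hγ) atTop (𝓝 ν) ∧
      (∀ Cs : List (ULoop3 F), Tendsto (fun K => (F.scheme ℰ γ).expectAt K Cs) atTop
        (𝓝 (∫ y, T4LimitLaw.monomial Cs y ∂(ν : Measure (T4LimitLaw.Cube (ULoop3 F)))))) ∧
      c ≤ Var[fun y => ((y (ULoop3.polyakov 0 x) : Set.Icc (-1 : ℝ) 1) : ℝ);
        (ν : Measure (T4LimitLaw.Cube (ULoop3 F)))] ∧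
      ∀ (m : ℝ) (v : NNReal), (ν : Measure (T4LimitLaw.Cube (ULoop3 F))).map
        (fun y => ((y (ULoop3.polyakov 0 x) : Set.Icc (-1 : ℝ) 1) : ℝ)) ≠ ProbabilityTheory.gaussianReal m v :=
  limitLoopLaw_nondegenerate F hE hγ (hasContinuumLimit_of_unitTiltTail hE hγ hr hw hw' h)
    (uniformVariance_polyakov_of_unitTiltTail hE hγ h hr hw hw' hr0 hw0 hw0' hx hc hsmall)

end SU2

end Literature.MathematicalPhysics.QuantumFieldTheory.Balaban1983to89.T3PolyakovVariance

end
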